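import Mathlib
import HarnessLib

/-!
# Full rational `2`-torsion ⟹ the discriminant is a rational SQUARE, hence has EVEN valuation at every prime
# (cell bsd-f2-manin, route `ManinLocalTwoThree`, crux C2 stmt-BirchSwinnertonDyer-22967; lead p1 gen 19 — habitat bookkeeping for E-an-152c, LEAD-MEMO v41 §2)

If the `2`-torsion polynomial `4x³ + b₂x² + 2b₄x + b₆` of a Weierstrass curve over `ℚ` splits with roots `x, y, z` (full rational `2`-torsion), then
`16Δ = disc = (16(x−y)(x−z)(y−z))²` (Mathlib `Cubic.discr_eq_prod_three_roots`, `WeierstrassCurve.twoTorsionPolynomial_discr`), so `Δ = (4(x−y)(x−z)(y−z))²` is a square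
in `ℚ` and `v_p(Δ)` is even at every prime `p` (for `Δ ≠ 0`).  Use (memo v41 §2): at a multiplicative prime the Tamagawa number `c_p ∈ {v_p(Δ_min), 1, 2}` is then EVEN
(`v_p(Δ_min) ≡ v_p(Δ) (mod 12)`), which is the parity input of the (K3) diagnostic for the index-`4` habitat.  Elementary; no definitions, no sorry; BSD / C2 not proved by this.
[cite: SilvermanAEC2009, III.1 (b-invariants, discriminant of the 2-division cubic)] [folklore]
-/

set_option autoImplicit false
-- lint-debt: the directory name repeats the summit name (sibling precedent `ManinLocalTwoThreeHalvingCoverUDC.lean`)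
set_option linter.dupNamespace false

namespace Summit.BirchSwinnertonDyer.BirchSwinnertonDyer.Theorems.ManinLocalTwoThree.FullTwoTorsionDisc

/-- **Full rational `2`-torsion ⟹ `Δ = (4(x−y)(x−z)(y−z))²`.** [folklore] -/
theorem Δ_eq_sq_of_roots (W : WeierstrassCurve ℚ) {x y z : ℚ} (h : W.twoTorsionPolynomial.roots = {x, y, z}) :
    W.Δ = (4 * (x - y) * (x - z) * (y - z)) ^ 2 := by
  have ha : W.twoTorsionPolynomial.a ≠ 0 := by simp [WeierstrassCurve.twoTorsionPolynomial]
  have h3 : (Cubic.map (RingHom.id ℚ) W.twoTorsionPolynomial).roots = {x, y, z} := by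
    rw [Cubic.map_roots, Polynomial.map_id]; exact h
  have hd := Cubic.discr_eq_prod_three_roots ha h3
  rw [WeierstrassCurve.twoTorsionPolynomial_discr] at hd
  simp only [RingHom.id_apply, WeierstrassCurve.twoTorsionPolynomial] at hd
  linear_combination hd / 16

/-- **Full rational `2`-torsion ⟹ `Δ` is a square in `ℚ`.** [folklore] -/
theorem isSquare_Δ_of_roots (W : WeierstrassCurve ℚ) {x y z : ℚ} (h : W.twoTorsionPolynomial.roots = {x, y, z}) : IsSquare W.Δ :=
  ⟨4 * (x - y) * (x - z) * (y - z), by rw [Δ_eq_sq_of_roots W h, sq]⟩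

/-- **Full rational `2`-torsion ⟹ `v_p(Δ)` is even at every prime** (Mathlib's `padicValRat p 0 = 0` makes `Δ = 0` harmless). [folklore] -/
theorem even_padicValRat_Δ_of_roots (W : WeierstrassCurve ℚ) {x y z : ℚ} (h : W.twoTorsionPolynomial.roots = {x, y, z})
    (p : ℕ) [Fact p.Prime] : Even (padicValRat p W.Δ) := by
  rw [Δ_eq_sq_of_roots W h, padicValRat.pow]
  exact even_two_mul _

end Summit.BirchSwinnertonDyer.BirchSwinnertonDyer.Theorems.ManinLocalTwoThree.FullTwoTorsionDisc
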